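import Summits.AnomalousDissipation.AnomalousDissipation.Theorems.PumpedMirrorMirrorFloorTGDuality
import Summits.AnomalousDissipation.AnomalousDissipation.Theorems.PumpedMirrorMirrorFloorTGExplicitEnergy

/-!
# Skeleton for crux `PumpedMirror.MirrorFloorTG` (stmt-AnomalousDissipation-15372), line `registered` — RESHAPE 3

Lead `prover-line-stmt-AnomalousDissipation-15372-c2-0` (2026-08-17, cycle 2 of the line). Route
`route-AnomalousDissipation-PumpedMirror` (rev 2), crux #2: the LOW-ENERGY MIRROR FLOOR — for the pinned Taylor–Green force
`f_TG` and every energy level `E > 0`, at every small `ν` ONE cylindrical test functional `Φ₁` and weight `θ₁ ≤ 0` certify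
`ε₀ ≤ ν‖∇u‖² + ⟨F_ν(u),Φ₁'(u)⟩ + 2θ₁((u,f_TG) − ν‖∇u‖²)` at every finite-enstrophy K-symmetric state `u ∈ H` with `|u|² ≤ E`.

## State of the line after cycle 2: COMPLETE modulo ONE registered stub = the crux restricted to energy levels `E ≥ 1/(8π)`

LANDED (kernel-checked, namespace `…Theorems.PumpedMirrorMirrorFloorTG`):
* c1: S1a `stub_sublevelCompactOn` p143356 · S1b `stub_minimaxAlternativeOn` p144181 · S1c `stub_penalisationLimitOn` p143738 ·
  S2 `stub_mirrorSlabClosed` p144596 · weak duality `mirrorLawsLoudTG_of_mirrorFloorTG` p145490 · `mirrorFloorTG_smallEnergy`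
  (crux below a non-explicit `E₁ ≈ 2·10⁻³`), `antiPumping_tg`, `fixedViscosity_floor` p146438 · STRONG DUALITY `floorMinimaxOn`,
  `mirrorFloorTG_of_mirrorLawsLoudTG`, `mirrorFloorTG_iff_mirrorLawsLoudTG` (CRUX ⟺ S3) p146584.
* c2: `abs_inertialPairing_tgForce_le` — SHARP stress bound `|I_{f_TG}(u)| ≤ 2π‖u‖²` on `L²` (`2π = max‖Def f_TG‖_op`, attained at
  the 8 stagnation points) p150141 · `mirrorFloorTG_below_inv_eight_pi` — THE CRUX VERBATIM for every `E < 1/(8π)`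
  (`0.0397 < 1/(8π) < 0.0398`; ε₀ = (¼ − 2πE)/2, θ₁ = 0, ν-independent work-functional certificate),
  `relaxed_empty_below_inv_eight_pi` + `mirrorLawsLoudTG_below_inv_eight_pi` (S3 below `1/(8π)`: the relaxed class is EMPTY),
  `fixedViscosity_floor_explicit` (free floor `ε(μ) ≥ (π/4)ν`, `ν ≤ 1/64`), `floor_uniform_of_stressBound` (plug-in: any solenoidal `w`
  with `|⟪∇w v,v⟫| ≤ K|v|²` certifies the crux uniformly below `(f_TG,w)/K`) — `…ExplicitEnergy.lean`.

Hence this reshape registers exactly ONE stub, S3 at large energy, `stub_mirrorLawsLoudTG_largeEnergy` (OPEN): for every level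
`E ≥ 1/(8π)`, every relaxed stationary K-statistic of `NS_ν(f_TG)` carried below energy `E` is `ε₀(E)`-loud uniformly in
`ν < ν₀(E)`. By `mirrorFloorTG_iff_mirrorLawsLoudTG` and `mirrorLawsLoudTG_below_inv_eight_pi` it is EQUIVALENT to the crux
(lead outcome `promote-stub` stands: crux-sized by theorem).

WHAT ANY ATTACK MUST FACE (c2 evidence `ELIN.md`; strategist census `STRATEGY-CENSUS.md` s1):
* `E_lin := sup{(f_TG,w) : w ∈ 𝒱, Def w ≽ −I} = min{mass τ : τ ≽ 0, div τ = f_TG + ∇p}` (LP duality) is the EXACT threshold of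
  ν-UNIFORM certifiability on the mirror slab (below: the linear certificate of `floor_uniform_of_stressBound`; above: K-symmetrised
  invisible wave packets at the origin fibre defeat every fixed `(Φ₁, θ₁)` as `ν → 0`); numerically `0.0716 ≤ E_lin ≤ 0.1225`
  (local; farm LP jobs pending), Lean-certified lower bound `1/(8π) = 0.0398`. No hierarchy of higher cylindrical identities helps at
  `ν = 0` (pure packet ensembles see only `Φ'(0)`); above `E_lin` a certificate must be ν-DEPENDENT and pay either resolution
  `N_Φ ≳ (ε₀/((1+2|θ₁|)νE))^{1/2}` or a multiplier `|θ₁|` up to `≍ 1/ν` (paid for on the laminar ray).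
* every refutation is a family `ν_j → 0` of relaxed K-statistics at ONE level `E ≥ 1/(8π)` (Lean) / `≥ E_lin` (LP) with
  `ε(μ_j) → 0`, each dissipating `≥ (π/4)ν_j`; quiet bounded steady K-branches are dimensionally allowed (`ν^{1/3}` edge layers)
  but unconstructible and numerically absent (runaway, loud); Gaussian / leaky fakes die on odd cubic flux tests.

Disproof.lean: none exists for this crux (`ledger crux ls`, 2026-08-17) — no `_false_without_<H>` obligation.
-/

noncomputable section

-- `Summit.<Summit>.<Problem>` is the tree's mandated summit-side namespace (CONVENTIONS §2); the duplicate is deliberate.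
set_option linter.dupNamespace false

namespace Summit.AnomalousDissipation.AnomalousDissipation.Cruxes.MirrorFloorTG.Birth

open MeasureTheory Filter Topology UnitAddTorus
open scoped InnerProductSpace ENNReal
open Literature.Analysis.FunctionSpaces Literature.Analysis.FluidPDE
open Summit.AnomalousDissipation.AnomalousDissipation.Theses.PumpedMirror
open Summit.AnomalousDissipation.AnomalousDissipation.Theorems.PumpedMirrorMirrorFloorTG
  (mirrorFloorTG_of_mirrorLawsLoudTG mirrorLawsLoudTG_of_mirrorFloorTG mirrorFloorTG_iff_mirrorLawsLoudTG
    mirrorLawsLoudTG_below_inv_eight_pi mirrorFloorTG_below_inv_eight_pi relaxed_empty_below_inv_eight_pi)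

/-! ## The stub (the only `sorry` of the file; signature in tree vocabulary) -/

/-- **S3 at large energy `stub_mirrorLawsLoudTG_largeEnergy`** — RELAXED K-STATISTICS OF `f_TG` BELOW ANY LEVEL `E ≥ 1/(8π)` ARE
LOUD (OPEN; the bet; the crux's entire remaining content — EQUIVALENT to the crux by `mirrorFloorTG_iff_mirrorLawsLoudTG` and
`mirrorLawsLoudTG_below_inv_eight_pi`). For the pinned force and every energy level `E ≥ 1/(8π)` there are `ε₀, ν₀ > 0` such that
for `ν ∈ (0, ν₀)` every Borel probability measure on `H` carried by `Fix K ∩ {|u|² ≤ E}`, of finite mean enstrophy, annihilating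
every cylindrical Liouville functional of `NS_ν(f_TG)`, with integrable work and `ν∫‖∇u‖²dμ ≤ ∫(u,f_TG)dμ`, has `ν∫‖∇u‖²dμ ≥ ε₀`.
SETTLED COMPLEMENT (landed): `E < 1/(8π)` — the class is empty (`relaxed_empty_below_inv_eight_pi`); fixed `ν ≤ 1/64` — every
relaxed statistic dissipates `≥ (π/4)ν` (`fixedViscosity_floor_explicit`). WHY IT MIGHT FAIL: one quiet relaxed stationary
K-statistic at a level `E ≥ E_lin` along `ν_j → 0` (packet-like ensembles realising a psd stress `τ` with `div τ = f_TG + ∇p` and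
vanishing dissipation; a quiet bounded steady K-state with `ν^{1/3}` edge layers; a leaky relaxed-but-not-dynamical measure with a
heavy enstrophy tail). WHY IT MIGHT HOLD: at `ν > 0` invisible scales pay `(1−2θ₁)ν k²` per unit energy; atoms are exact steady weak
K-states (Kelvin pump `KelvinPumpSteadyTG`, `NoSmoothMirrorDodgerTG`); anti-pumping `∫I_{f_TG}dμ → −¼` forces an O(1) Reynolds
stress against `∇f_TG` spread over the whole cell (`curl f_TG ≠ 0` a.e.). [arXiv:1705.07096; arXiv:2010.06730;
FMRTTurbulence2001 IV–V; doi:10.1017/s0022112083001159] -/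
theorem stub_mirrorLawsLoudTG_largeEnergy :
    ∀ f : UnitAddTorus (Fin 3) → EuclideanSpace ℝ (Fin 3),
      f = (fun x => !₂[(fourier 1 (x 0) : ℂ).im * (fourier 1 (x 1) : ℂ).re * (fourier 1 (x 2) : ℂ).re,
        -((fourier 1 (x 0) : ℂ).re * (fourier 1 (x 1) : ℂ).im * (fourier 1 (x 2) : ℂ).re), (0 : ℝ)]) →
    ∀ E : ℝ, 1 / (8 * Real.pi) ≤ E → ∃ ε₀ ν₀ : ℝ, 0 < ε₀ ∧ 0 < ν₀ ∧ ∀ ν : ℝ, 0 < ν → ν < ν₀ →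
      ∀ μ : Measure (Torus.energySpace (Fin 3)), IsProbabilityMeasure μ →
        (∀ᵐ u ∂μ, ∀ i j : Fin 3,
          (fun x => (u.1 : UnitAddTorus (Fin 3) → EuclideanSpace ℝ (Fin 3)) (Function.update x i (-x i)) j)
            =ᵐ[volume]
          (fun x => if j = i then -((u.1 : UnitAddTorus (Fin 3) → EuclideanSpace ℝ (Fin 3)) x j)
            else (u.1 : UnitAddTorus (Fin 3) → EuclideanSpace ℝ (Fin 3)) x j)) →
        (∀ᵐ u ∂μ, ‖u‖ ^ 2 ≤ E) →
        Torus.ensembleEnstrophy μ < ⊤ →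
        (∀ Φ : Torus.CylindricalTest (Fin 3),
          Integrable (fun u => Torus.nsGeneratorPairing ν f u (Φ.grad u)) μ ∧
            ∫ u, Torus.nsGeneratorPairing ν f u (Φ.grad u) ∂μ = 0) →
        Integrable (fun u : Torus.energySpace (Fin 3) => Torus.pairing u.1 f) μ →
        Torus.ensembleDissipation ν μ ≤ ∫ u, Torus.pairing u.1 f ∂μ →
        ε₀ ≤ Torus.ensembleDissipation ν μ := by
  sorry

/-! ## Name-keyed alias of the stub statement — the hypothesis of `MirrorFloorTG_of` -/
namespace __Registered

/-- Alias of the large-energy S3 statement keyed by the registered stub name (an `abbrev`, definitionally the statement). -/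
abbrev stub_mirrorLawsLoudTG_largeEnergy : Prop :=
  ∀ f : UnitAddTorus (Fin 3) → EuclideanSpace ℝ (Fin 3),
    f = (fun x => !₂[(fourier 1 (x 0) : ℂ).im * (fourier 1 (x 1) : ℂ).re * (fourier 1 (x 2) : ℂ).re,
      -((fourier 1 (x 0) : ℂ).re * (fourier 1 (x 1) : ℂ).im * (fourier 1 (x 2) : ℂ).re), (0 : ℝ)]) →
  ∀ E : ℝ, 1 / (8 * Real.pi) ≤ E → ∃ ε₀ ν₀ : ℝ, 0 < ε₀ ∧ 0 < ν₀ ∧ ∀ ν : ℝ, 0 < ν → ν < ν₀ →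
    ∀ μ : Measure (Torus.energySpace (Fin 3)), IsProbabilityMeasure μ →
      (∀ᵐ u ∂μ, ∀ i j : Fin 3,
        (fun x => (u.1 : UnitAddTorus (Fin 3) → EuclideanSpace ℝ (Fin 3)) (Function.update x i (-x i)) j)
          =ᵐ[volume]
        (fun x => if j = i then -((u.1 : UnitAddTorus (Fin 3) → EuclideanSpace ℝ (Fin 3)) x j)
          else (u.1 : UnitAddTorus (Fin 3) → EuclideanSpace ℝ (Fin 3)) x j)) →
      (∀ᵐ u ∂μ, ‖u‖ ^ 2 ≤ E) →
      Torus.ensembleEnstrophy μ < ⊤ →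
      (∀ Φ : Torus.CylindricalTest (Fin 3),
        Integrable (fun u => Torus.nsGeneratorPairing ν f u (Φ.grad u)) μ ∧
          ∫ u, Torus.nsGeneratorPairing ν f u (Φ.grad u) ∂μ = 0) →
      Integrable (fun u : Torus.energySpace (Fin 3) => Torus.pairing u.1 f) μ →
      Torus.ensembleDissipation ν μ ≤ ∫ u, Torus.pairing u.1 f ∂μ →
      ε₀ ≤ Torus.ensembleDissipation ν μ

end __Registered

/-! ## Glue (kernel-checked): S3 at every level from its large-energy part -/

/-- **S3 from its large-energy part**: below `1/(8π)` the relaxed class is empty (`mirrorLawsLoudTG_below_inv_eight_pi`, landed), so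
S3 at levels `E ≥ 1/(8π)` gives S3 at every level `E > 0`. (= `mirrorLawsLoudTG_of_largeEnergy` of `…ReducedCrux.lean`, inlined.) -/
theorem mirrorLawsLoudTG_of_largeEnergy' (hlarge : __Registered.stub_mirrorLawsLoudTG_largeEnergy) :
    ∀ f : UnitAddTorus (Fin 3) → EuclideanSpace ℝ (Fin 3),
      f = (fun x => !₂[(fourier 1 (x 0) : ℂ).im * (fourier 1 (x 1) : ℂ).re * (fourier 1 (x 2) : ℂ).re,
        -((fourier 1 (x 0) : ℂ).re * (fourier 1 (x 1) : ℂ).im * (fourier 1 (x 2) : ℂ).re), (0 : ℝ)]) →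
    ∀ E : ℝ, 0 < E → ∃ ε₀ ν₀ : ℝ, 0 < ε₀ ∧ 0 < ν₀ ∧ ∀ ν : ℝ, 0 < ν → ν < ν₀ →
      ∀ μ : Measure (Torus.energySpace (Fin 3)), IsProbabilityMeasure μ →
        (∀ᵐ u ∂μ, ∀ i j : Fin 3,
          (fun x => (u.1 : UnitAddTorus (Fin 3) → EuclideanSpace ℝ (Fin 3)) (Function.update x i (-x i)) j)
            =ᵐ[volume]
          (fun x => if j = i then -((u.1 : UnitAddTorus (Fin 3) → EuclideanSpace ℝ (Fin 3)) x j)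
            else (u.1 : UnitAddTorus (Fin 3) → EuclideanSpace ℝ (Fin 3)) x j)) →
        (∀ᵐ u ∂μ, ‖u‖ ^ 2 ≤ E) →
        Torus.ensembleEnstrophy μ < ⊤ →
        (∀ Φ : Torus.CylindricalTest (Fin 3),
          Integrable (fun u => Torus.nsGeneratorPairing ν f u (Φ.grad u)) μ ∧
            ∫ u, Torus.nsGeneratorPairing ν f u (Φ.grad u) ∂μ = 0) →
        Integrable (fun u : Torus.energySpace (Fin 3) => Torus.pairing u.1 f) μ →
        Torus.ensembleDissipation ν μ ≤ ∫ u, Torus.pairing u.1 f ∂μ →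
        ε₀ ≤ Torus.ensembleDissipation ν μ := by
  intro f hf E hE
  by_cases hlt : E < 1 / (8 * Real.pi)
  · exact mirrorLawsLoudTG_below_inv_eight_pi f hf E hE hlt
  · exact hlarge f hf E (not_lt.1 hlt)

/-! ## The composition: `MirrorFloorTG` from the single stub (kernel-checked; no `sorry` of its own) -/

/-- **`MirrorFloorTG` from S3-at-large-energy** — the landed strong duality on the mirror slab
(`mirrorFloorTG_of_mirrorLawsLoudTG`: S1a–S1c + S2 + `f_TG` smooth, margin `ε₀/2`) after the glue above. -/
theorem MirrorFloorTG_of : __Registered.stub_mirrorLawsLoudTG_largeEnergy → MirrorFloorTG :=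
  fun hlarge => mirrorFloorTG_of_mirrorLawsLoudTG (mirrorLawsLoudTG_of_largeEnergy' hlarge)

/-- Conversely the crux gives the stub back (landed weak duality): the stub is EXACTLY the crux. -/
theorem stub_iff_crux : __Registered.stub_mirrorLawsLoudTG_largeEnergy ↔ MirrorFloorTG :=
  ⟨MirrorFloorTG_of, fun h f hf E hE => (mirrorLawsLoudTG_of_mirrorFloorTG h) f hf E (lt_of_lt_of_le (by positivity) hE)⟩

/-- The crux below the explicit energy level `1/(8π)` is SETTLED (landed, c2): recorded here so that the skeleton displays the
settled / open split of the `E`-axis. -/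
example : ∀ f : UnitAddTorus (Fin 3) → EuclideanSpace ℝ (Fin 3),
    f = (fun x => !₂[(fourier 1 (x 0) : ℂ).im * (fourier 1 (x 1) : ℂ).re * (fourier 1 (x 2) : ℂ).re,
      -((fourier 1 (x 0) : ℂ).re * (fourier 1 (x 1) : ℂ).im * (fourier 1 (x 2) : ℂ).re), (0 : ℝ)]) →
    ∀ E : ℝ, 0 < E → E < 1 / (8 * Real.pi) → ∃ (ε₀ ν₀ : ℝ), 0 < ε₀ ∧ 0 < ν₀ ∧ ∀ ν : ℝ, 0 < ν → ν < ν₀ →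
      ∃ (Φ₁ : Torus.CylindricalTest (Fin 3)) (θ₁ : ℝ), θ₁ ≤ 0 ∧
        ∀ u : Torus.energySpace (Fin 3),
          let uf : UnitAddTorus (Fin 3) → EuclideanSpace ℝ (Fin 3) :=
            ((u : Lp (EuclideanSpace ℝ (Fin 3)) 2 (volume : Measure (UnitAddTorus (Fin 3)))) :
              UnitAddTorus (Fin 3) → EuclideanSpace ℝ (Fin 3))
          let D : ℝ := ν * (Torus.eGradNormSq uf).toReal
          let P : ℝ := Torus.pairing (u : Lp (EuclideanSpace ℝ (Fin 3)) 2 (volume : Measure (UnitAddTorus (Fin 3)))) f - D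
          (∀ i j : Fin 3, (fun x => uf (Function.update x i (-x i)) j) =ᵐ[volume]
              (fun x => if j = i then -(uf x j) else uf x j)) →
            Torus.eGradNormSq uf ≠ ⊤ → ‖u‖ ^ 2 ≤ E →
              ε₀ ≤ D + Torus.nsGeneratorPairing ν f u (Φ₁.grad u) + 2 * θ₁ * P :=
  mirrorFloorTG_below_inv_eight_pi

/-- WIRING CHECK: the sorried stub composes to a closed term of the crux's type (modulo its `sorry`).
Deliberately an `example` (no constant enters the environment). -/
example : MirrorFloorTG :=
  MirrorFloorTG_of stub_mirrorLawsLoudTG_largeEnergy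

end Summit.AnomalousDissipation.AnomalousDissipation.Cruxes.MirrorFloorTG.Birth

end
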